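import Summits.Ventures.PercRepro.HyperplaneKey
import Summits.Ventures.PercRepro.HyperplaneKeyCount
import Summits.Ventures.PercRepro.HyperplaneKeyFive
import Summits.Ventures.PercRepro.RankLevelSetLocalSparse

/-!
# PercRepro — THE HYPERPLANE KEY AT EVERY LEVEL `q`: A FINITE WINDOW OF CORANKS FOR EVERY ROW (p1, gen 42; S2 / S3 / S4 feeder)

The key `rls_of_hyperplane_key` needs a cap `A` on `#{ρ ≤ q}` with `(Φ(p,q) + 1)·A ≤ 2^{⌊n/2⌋}`. Here the cap is made uniform in
`q`: with flat bounds `f j` on the rank-`≤ j` sets (`j ≤ q`) the basis-fibre count gives `#{ρ ≤ q} ≤ Σ_{j ≤ q} C(n, j)·2^{f j − j}`,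
and this sum at most doubles from `n` to `n + 2` once `n ≥ 4q` (`C(n+2, j) ≤ 2·C(n, j)`, `choose_add_two_le_two_mul`), so TWO
consecutive base values `n₀, n₀ + 1` give the key for every `n ≥ n₀` (`key_of_two_base`). In the `e`-free core every rank-`j`
set has `≤ 2^j − 1` points (`ThmN.ncard_add_one_le_two_pow_of_eRk_le`), so the cap needs no further input:
**`rls_of_hyperplane_key_two_base`** — `e`-free, `ρ(E) = p`, `n ≥ n₀ ≥ 4q`, the two numeric base inequalities ⟹ `RLS M p q`.
Hence at EVERY level `q` the open cells `(p, d)` of a row form a FINITE window `d < n₀(p, q) − p`; the two base inequalities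
are checked by `norm_num` per `(p, q, n₀)` (the sharper flat bounds of the tree — `f(3..6) = 6, 10, 19, 39` — go in through
`rls_of_hyperplane_key_two_base_of_flat`). Nothing about any cell is claimed here.

* `choose_add_two_le_two_mul` — `C(n+2, j) ≤ 2·C(n, j)` for `4j ≤ n`;
* `sum_choose_mul_add_two_le` — the cap sum at most doubles from `n` to `n + 2` for `n ≥ 4q`;
* `ncard_eRk_le_le_of_free_two_pow` — `#{ρ ≤ q} ≤ Σ_{j ≤ q} C(n, j)·2^{2^j − 1 − j}` in an `e`-free matroid;
* `rls_of_hyperplane_key_two_base_of_flat` — the key from flat bounds `f` and two base values;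
* `rls_of_hyperplane_key_two_base` — the same with `f j = 2^j − 1`.
Axioms: standard.
-/

open scoped Matroid

namespace PercRepro

namespace HypKey

open Set

variable {α : Type}

/-- `C(n + 2, j) ≤ 2·C(n, j)` for `4·j ≤ n` (Pascal twice: `C(n+2, j) = C(n, j) + 2·C(n, j−1) + C(n, j−2)`, and the ratio
`C(n, j) / C(n, j−1) = (n − j + 1)/j ≥ 3` beats `2 + (j − 1)/(n − j + 2)`). -/
theorem choose_add_two_le_two_mul (n j : ℕ) (hn : 4 * j ≤ n) : (n + 2).choose j ≤ 2 * n.choose j := by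
  rcases j with _ | j
  · simp
  rcases j with _ | j
  · simp; omega
  show (n + 2).choose (j + 2) ≤ 2 * n.choose (j + 2)
  have h1 : (n + 1).choose (j + 1) = n.choose j + n.choose (j + 1) := Nat.choose_succ_succ n j
  have h2 : (n + 1).choose (j + 2) = n.choose (j + 1) + n.choose (j + 2) := Nat.choose_succ_succ n (j + 1)
  have h3 : (n + 2).choose (j + 2) = (n + 1).choose (j + 1) + (n + 1).choose (j + 2) :=
    Nat.choose_succ_succ (n + 1) (j + 1)
  have hp : (n + 2).choose (j + 2) = n.choose (j + 2) + 2 * n.choose (j + 1) + n.choose j := by omega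
  rw [hp]
  have e1 : n.choose (j + 2) * (j + 2) = n.choose (j + 1) * (n - (j + 1)) := Nat.choose_succ_right_eq n (j + 1)
  have e2 : n.choose (j + 1) * (j + 1) = n.choose j * (n - j) := Nat.choose_succ_right_eq n j
  have q1 : (n.choose (j + 2) : ℚ) * (j + 2) = n.choose (j + 1) * ((n : ℚ) - (j + 1)) := by
    have := congrArg (fun x : ℕ => (x : ℚ)) e1
    push_cast [Nat.cast_sub (show j + 1 ≤ n by omega)] at this
    linarith
  have q2 : (n.choose (j + 1) : ℚ) * (j + 1) = n.choose j * ((n : ℚ) - j) := by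
    have := congrArg (fun x : ℕ => (x : ℚ)) e2
    push_cast [Nat.cast_sub (show j ≤ n by omega)] at this
    linarith
  have hc1 : (0 : ℚ) ≤ n.choose (j + 1) := Nat.cast_nonneg _
  have hnq : (4 * ((j : ℚ) + 2)) ≤ n := by exact_mod_cast hn
  have hpoly : (0 : ℚ) ≤ ((n : ℚ) - j - 1) * ((n : ℚ) - j) - 2 * ((j : ℚ) + 2) * ((n : ℚ) - j)
      - ((j : ℚ) + 1) * ((j : ℚ) + 2) := by nlinarith
  have hmain : ((2 * n.choose (j + 1) + n.choose j : ℚ)) * (((j : ℚ) + 2) * ((n : ℚ) - j)) ≤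
      (n.choose (j + 2) : ℚ) * (((j : ℚ) + 2) * ((n : ℚ) - j)) := by
    nlinarith [q1, q2, mul_nonneg hc1 hpoly]
  have hpos : (0 : ℚ) < ((j : ℚ) + 2) * ((n : ℚ) - j) := by
    apply mul_pos <;> linarith
  have h := le_of_mul_le_mul_right hmain hpos
  have h' : 2 * n.choose (j + 1) + n.choose j ≤ n.choose (j + 2) := by exact_mod_cast h
  omega

/-- The cap sum `Σ_{j ≤ q} C(n, j)·w_j` (`w ≥ 0`) at most doubles from `n` to `n + 2` once `n ≥ 4q`. -/
theorem sum_choose_mul_add_two_le (q n : ℕ) (w : ℕ → ℚ) (hw : ∀ j, 0 ≤ w j) (hn : 4 * q ≤ n) :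
    ∑ j ∈ Finset.range (q + 1), ((n + 2).choose j : ℚ) * w j ≤
      2 * ∑ j ∈ Finset.range (q + 1), (n.choose j : ℚ) * w j := by
  rw [Finset.mul_sum]
  refine Finset.sum_le_sum (fun j hj => ?_)
  have hjq : j ≤ q := Nat.lt_succ_iff.1 (Finset.mem_range.1 hj)
  have h := choose_add_two_le_two_mul n j (by omega)
  have hq : ((n + 2).choose j : ℚ) ≤ 2 * (n.choose j : ℚ) := by exact_mod_cast h
  calc ((n + 2).choose j : ℚ) * w j ≤ 2 * (n.choose j : ℚ) * w j :=
        mul_le_mul_of_nonneg_right hq (hw j)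
    _ = 2 * ((n.choose j : ℚ) * w j) := by ring

/-- **The rank-`≤ q` count of an `e`-free matroid with no further input**: every rank-`j` set has `≤ 2^j − 1` points, so
`#{ρ ≤ q} ≤ Σ_{j ≤ q} C(n, j)·2^{2^j − 1 − j}`. -/
theorem ncard_eRk_le_le_of_free_two_pow (M : Matroid α) [M.Finite]
    (hfree : ∀ e ∈ M.E, ∃ A ⊆ M.E \ {e}, e ∉ M.closure A ∧ e ∉ M.closure ((M.E \ {e}) \ A)) (q : ℕ) :
    {X : Set α | X ⊆ M.E ∧ M.eRk X ≤ (q : ℕ∞)}.ncard ≤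
      ∑ j ∈ Finset.range (q + 1), M.E.ncard.choose j * 2 ^ (2 ^ j - 1 - j) := by
  refine ncard_eRk_le_le_sum_choose M q (fun j => 2 ^ j - 1) (fun j _ X hX hr => ?_)
  have := ThmN.ncard_add_one_le_two_pow_of_eRk_le M (ThmN.not_isLoop_of_free M hfree) hfree j X hX hr
  omega

/-- **THE HYPERPLANE KEY FROM FLAT BOUNDS AND TWO BASE VALUES.** `e`-free, `ρ(E) = p`, rank-`≤ j` sets of `≤ f j` points
(`j ≤ q`), `n ≥ n₀ ≥ 4q`, and `(Φ(p,q) + 1)·Σ_{j ≤ q} C(m, j)·2^{f j − j} ≤ 2^{⌊m/2⌋}` at `m = n₀` and `m = n₀ + 1`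
give `ThmN.RLS M p q`. -/
theorem rls_of_hyperplane_key_two_base_of_flat (M : Matroid α) [M.Finite] (p q : ℕ) (hR : M.eRank = (p : ℕ∞))
    (hfree : ∀ e ∈ M.E, ∃ A ⊆ M.E \ {e}, e ∉ M.closure A ∧ e ∉ M.closure ((M.E \ {e}) \ A))
    (f : ℕ → ℕ) (hf : ∀ j ≤ q, ∀ X ⊆ M.E, M.eRk X ≤ (j : ℕ∞) → X.ncard ≤ f j)
    (n₀ : ℕ) (h4 : 4 * q ≤ n₀) (hn : n₀ ≤ M.E.ncard)
    (h0 : (phiK p q + 1) * ∑ j ∈ Finset.range (q + 1), (n₀.choose j : ℚ) * 2 ^ (f j - j) ≤ (2 : ℚ) ^ (n₀ / 2))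
    (h1 : (phiK p q + 1) * ∑ j ∈ Finset.range (q + 1), ((n₀ + 1).choose j : ℚ) * 2 ^ (f j - j) ≤
      (2 : ℚ) ^ ((n₀ + 1) / 2)) :
    ThmN.RLS M p q := by
  have hcap := ncard_eRk_le_le_sum_choose M q f hf
  have hcapq : ({X : Set α | X ⊆ M.E ∧ M.eRk X ≤ (q : ℕ∞)}.ncard : ℚ) ≤
      ∑ j ∈ Finset.range (q + 1), (M.E.ncard.choose j : ℚ) * 2 ^ (f j - j) := by
    exact_mod_cast hcap
  refine rls_of_hyperplane_key M p q hR hfree _ hcapq ?_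
  have hΦ : 0 ≤ phiK p q + 1 := by linarith [phiK_nonneg p q]
  refine key_of_two_base (fun m => (phiK p q + 1) * ∑ j ∈ Finset.range (q + 1),
    (m.choose j : ℚ) * 2 ^ (f j - j)) n₀ (fun m hm => ?_) h0 h1 M.E.ncard hn
  have := sum_choose_mul_add_two_le q m (fun j => (2 : ℚ) ^ (f j - j)) (fun j => by positivity)
    (le_trans h4 hm)
  nlinarith [this, hΦ]

/-- **THE HYPERPLANE KEY AT EVERY LEVEL, WITH THE UNIVERSAL `e`-FREE FLAT BOUNDS `2^j − 1`**: `e`-free, `ρ(E) = p`,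
`n ≥ n₀ ≥ 4q` and the two base inequalities at `n₀`, `n₀ + 1` give `ThmN.RLS M p q`. -/
theorem rls_of_hyperplane_key_two_base (M : Matroid α) [M.Finite] (p q : ℕ) (hR : M.eRank = (p : ℕ∞))
    (hfree : ∀ e ∈ M.E, ∃ A ⊆ M.E \ {e}, e ∉ M.closure A ∧ e ∉ M.closure ((M.E \ {e}) \ A))
    (n₀ : ℕ) (h4 : 4 * q ≤ n₀) (hn : n₀ ≤ M.E.ncard)
    (h0 : (phiK p q + 1) * ∑ j ∈ Finset.range (q + 1), (n₀.choose j : ℚ) * 2 ^ (2 ^ j - 1 - j) ≤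
      (2 : ℚ) ^ (n₀ / 2))
    (h1 : (phiK p q + 1) * ∑ j ∈ Finset.range (q + 1), ((n₀ + 1).choose j : ℚ) * 2 ^ (2 ^ j - 1 - j) ≤
      (2 : ℚ) ^ ((n₀ + 1) / 2)) :
    ThmN.RLS M p q :=
  rls_of_hyperplane_key_two_base_of_flat M p q hR hfree (fun j => 2 ^ j - 1)
    (fun j _ X hX hr => by
      have := ThmN.ncard_add_one_le_two_pow_of_eRk_le M (ThmN.not_isLoop_of_free M hfree) hfree j X hX hr
      omega)
    n₀ h4 hn h0 h1

end HypKey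

end PercRepro
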